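import Literature.NumberTheory.Automorphic.AdelicPiSchwartzBruhatFourierInversion
import Literature.NumberTheory.Automorphic.AdelicSchwartzBruhatTensor
import Literature.NumberTheory.Automorphic.SchwartzBruhatCosetIndicator
import Mathlib.Analysis.Calculus.BumpFunction.FiniteDimension
import HarnessLib

/-!
# Archimedean tensor stripping on `𝒮(𝔸_K^ι) = 𝓢((K ⊗ ℝ)^ι) ⊗ 𝒮((𝔸_K^∞)^ι)`

Topic `NumberTheory/Automorphic`; namespace `Literature.NumberTheory.Automorphic`. Origin: `pub-hodgecm`
MODEL-CONSTRUCTION sub-cell, junction (S-∞) of RULING J-W2glob-7 ("archimedean stripping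
`s(g_∞, 1) = A(g_∞) ⊗ 1` = pure algebra + the sharp finite bi-annihilator"). KERNEL MATHEMATICS ONLY: every
declaration below is proved; no `def … : Prop` record, no cited hypothesis.

THE STATEMENT. Let `M` be a `ℂ`-linear endomorphism of the adelic Schwartz–Bruhat space
`𝒮(𝔸_K^ι) = piSchwartzBruhat K ι` which commutes with the FINITE Heisenberg operators: the translations
`Φ ↦ Φ((0, k) + ·)` and the modulations `Φ ↦ ψ_K(Σ_i (0, y)_i v_i) Φ`, `k, y ∈ (𝔸_K^∞)^ι` (`translateLM`,
`modulateLM` at the finite vectors `piAdeleSplit (0, k)`). Then for every compact open subgroup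
`L ≤ (𝔸_K^∞)^ι` there is a linear operator `archFactor M L` on `𝓢((K ⊗ ℝ)^ι)` with

  `M (φ ⊗ 𝟙_{x₀ + L}) = (archFactor M L φ) ⊗ 𝟙_{x₀ + L}`   for all `φ`, `x₀`

(`map_tmul_indicator`, `map_tmul_translate_indicator`, `map_thinCosetTestFunₗ`): on the test functions of a
fixed level, `M` IS `A ⊗ 1`. This is the algebraic half of "an operator commuting with `ρ(H(𝔸_f))` is of the
form `A ⊗ 1`" used to strip the archimedean component `s(g_∞, 1)` of a metaplectic splitting
([Weil1964, Chap. III n° 37–39]; [GelbartRogawski1991, §3.1 p. 454]).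

THE ENGINE is the SHARP BI-ANNIHILATOR (`dualBox_dualBox_eq`): for a compact open subgroup `L` of
`(𝔸_K^∞)^ι` and `L^♮ := {y | ψ_f(Σ_i y_i b_i) = 1 ∀ b ∈ L}` (`dualBox`), **`(L^♮)^♮ = L`**. It is proved here
from ADELIC FOURIER INVERSION (`adelicPiFourier_adelicPiFourier` of `AdelicPiSchwartzBruhatFourierInversion`,
Tate's Thm. 4.1.2) applied to `φ₀ ⊗ 𝟙_L`: the finite Fourier transform of `𝟙_L` is `μ(L) 𝟙_{L^♮}`
(orthogonality, `finitePiFourier_indicator_addSubgroup`), so `𝓕𝓕(φ₀ ⊗ 𝟙_L)` is a multiple of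
`(…) ⊗ 𝟙_{L^♮♮}`, while inversion says it is `ν(D^ι)² (φ₀ ⊗ 𝟙_L)(-·)`; comparing the finite factors gives
`𝟙_{L^♮♮} = 𝟙_L` — no arithmetic of the different ideal is needed. With it, the FIXED-VECTOR LEMMA
(`coe_eq_of_fixed`, `eq_tmul_indicator_of_fixed`): a vector of `𝒮(𝔸_K^ι)` fixed by the translations by `L`
and by the modulations by `L^♮` is `φ' ⊗ 𝟙_L` with `φ' = ` its archimedean slice at `b = 0`
(`archSliceLM`, `(archSliceLM b u)(a) = u(a, b)`), and the stripping statements follow by pure algebra.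

Contents: §1 the operators `translateLM`, `modulateLM` on `piSchwartzBruhat` and `finTranslateSB`,
`finModulateSB` on `𝒮((𝔸_K^∞)^ι)`, with `translateLM (0,k) = 1 ⊗ finTranslateSB k`,
`modulateLM (0,y) = 1 ⊗ finModulateSB y` (`translateLM_finVec_eq_adelicTensorEnd`,
`modulateLM_finVec_eq_adelicTensorEnd`); §2 the archimedean slice `archSliceLM`; §3 `dualBox`, orthogonality,
the split form of the adelic transform on products (`adelicPiFourier_split_mul`) and `dualBox_dualBox_eq`;
§4 the fixed-vector lemma; §5 `archFactor` and the stripping identities.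

## References

* [Weil1964] A. Weil, *Sur certains groupes d'opérateurs unitaires*, Acta Math. 111 (1964), Chap. I n° 4
  p. 149 (the operators `U(w)`), Chap. III n° 37–39 (adelic standard functions, product structure).
* [GelbartRogawski1991] S. Gelbart, J. Rogawski, *L-functions and Fourier–Jacobi coefficients for the
  unitary group U(3)*, Invent. math. 105 (1991), §3.1 p. 454 (the pairs `(g, M_g)`).
* [CasselsFrohlichANT1967] J. Tate, *Fourier analysis in number fields and Hecke's zeta-functions*, Ch. XV,
  Thm. 4.1.2 (inversion), Lemma 4.2.3 (orthogonality on compact subgroups).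
-/

noncomputable section

open MeasureTheory MeasureTheory.Measure NumberField NumberField.InfinitePlace NumberField.mixedEmbedding
  IsDedekindDomain Filter Topology
open scoped SchwartzMap NNReal ENNReal FourierTransform Classical TensorProduct ContDiff Pointwise

namespace Literature.NumberTheory.Automorphic

/-! ## 1. Heisenberg translations and modulations on `𝒮(𝔸_K^ι)` and on `𝒮((𝔸_K^∞)^ι)` -/

section Operators

variable (K : Type) [Field K] [NumberField K] (ι : Type) [Fintype ι]

/-- **Translation** `Φ ↦ Φ(x + ·)` on `𝒮(𝔸_K^ι) = piSchwartzBruhat K ι`, `x ∈ 𝔸_K^ι` (Weil's `U(w)` at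
`w = (x, 0)`). [cite: Weil1964, Chap. I n° 4 p. 149] -/
def translateLM (x : ι → AdeleRing (𝓞 K) K) : ↥(piSchwartzBruhat K ι) →ₗ[ℂ] ↥(piSchwartzBruhat K ι) where
  toFun Φ := ⟨fun v => (Φ : (ι → AdeleRing (𝓞 K) K) → ℂ) (x + v), comp_add_left_mem_piSchwartzBruhat Φ.2 x⟩
  map_add' _ _ := rfl
  map_smul' _ _ := rfl

/-- `translateLM x Φ` as a function. [folklore] -/
@[simp] theorem coe_translateLM_apply (x : ι → AdeleRing (𝓞 K) K) (Φ : ↥(piSchwartzBruhat K ι)) :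
    ((translateLM K ι x Φ : ↥(piSchwartzBruhat K ι)) : (ι → AdeleRing (𝓞 K) K) → ℂ) =
      fun v => (Φ : (ι → AdeleRing (𝓞 K) K) → ℂ) (x + v) := rfl

/-- **Modulation** `Φ ↦ ψ_K(Σ_i y_i v_i) Φ` on `𝒮(𝔸_K^ι)`, `y ∈ 𝔸_K^ι` (Weil's `U(w)` at `w = (0, y)`).
[cite: Weil1964, Chap. I n° 4 p. 149] -/
def modulateLM (y : ι → AdeleRing (𝓞 K) K) : ↥(piSchwartzBruhat K ι) →ₗ[ℂ] ↥(piSchwartzBruhat K ι) where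
  toFun Φ := ⟨fun v => (adeleAddChar K (∑ i, y i * v i) : ℂ) * (Φ : (ι → AdeleRing (𝓞 K) K) → ℂ) v,
    adeleAddChar_mul_mem_piSchwartzBruhat Φ.2 y⟩
  map_add' Φ Ψ := Subtype.ext (funext fun v => by
    simp only [Submodule.coe_add, Pi.add_apply, mul_add])
  map_smul' c Φ := Subtype.ext (funext fun v => by
    simp only [Submodule.coe_smul, Pi.smul_apply, smul_eq_mul, RingHom.id_apply, mul_left_comm])

/-- `modulateLM y Φ` as a function. [folklore] -/
@[simp] theorem coe_modulateLM_apply (y : ι → AdeleRing (𝓞 K) K) (Φ : ↥(piSchwartzBruhat K ι)) :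
    ((modulateLM K ι y Φ : ↥(piSchwartzBruhat K ι)) : (ι → AdeleRing (𝓞 K) K) → ℂ) =
      fun v => (adeleAddChar K (∑ i, y i * v i) : ℂ) * (Φ : (ι → AdeleRing (𝓞 K) K) → ℂ) v := rfl

/-- **Finite translation** `f ↦ f(k + ·)` on `𝒮((𝔸_K^∞)^ι)`. [folklore] -/
def finTranslateSB (k : ι → FiniteAdeleRing (𝓞 K) K) : FinSB K ι →ₗ[ℂ] FinSB K ι where
  toFun f := ⟨fun b => (f : (ι → FiniteAdeleRing (𝓞 K) K) → ℂ) (k + b),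
    comp_add_left_mem_schwartzBruhat f.2 k⟩
  map_add' _ _ := rfl
  map_smul' _ _ := rfl

omit [Fintype ι] in
/-- `finTranslateSB k f` as a function. [folklore] -/
@[simp] theorem coe_finTranslateSB_apply (k : ι → FiniteAdeleRing (𝓞 K) K) (f : FinSB K ι) :
    ((finTranslateSB K ι k f : FinSB K ι) : (ι → FiniteAdeleRing (𝓞 K) K) → ℂ) =
      fun b => (f : (ι → FiniteAdeleRing (𝓞 K) K) → ℂ) (k + b) := rfl

/-- Multiplying a Schwartz–Bruhat function on `(𝔸_K^∞)^ι` by the locally constant character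
`b ↦ ψ_f(Σ_i y_i b_i)` keeps it Schwartz–Bruhat. [folklore] -/
theorem finiteAdeleAddChar_mul_mem_schwartzBruhat (y : ι → FiniteAdeleRing (𝓞 K) K)
    {f : (ι → FiniteAdeleRing (𝓞 K) K) → ℂ} (hf : f ∈ SchwartzBruhat (ι → FiniteAdeleRing (𝓞 K) K)) :
    (fun b => (finiteAdeleAddChar K (∑ i, y i * b i) : ℂ) * f b) ∈
      SchwartzBruhat (ι → FiniteAdeleRing (𝓞 K) K) := by
  have hc : Continuous fun b : ι → FiniteAdeleRing (𝓞 K) K => ∑ i, y i * b i :=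
    continuous_finsetSum _ fun i _ => continuous_const.mul (continuous_apply i)
  exact (mem_schwartzBruhat_iff).2
    ⟨((Weil1964.isLocallyConstant_finiteAdeleAddChar K).comp_continuous hc).mul hf.1, hf.2.mul_left⟩

/-- **Finite modulation** `f ↦ ψ_f(Σ_i y_i b_i) f` on `𝒮((𝔸_K^∞)^ι)`. [folklore] -/
def finModulateSB (y : ι → FiniteAdeleRing (𝓞 K) K) : FinSB K ι →ₗ[ℂ] FinSB K ι where
  toFun f := ⟨fun b => (finiteAdeleAddChar K (∑ i, y i * b i) : ℂ) *
      (f : (ι → FiniteAdeleRing (𝓞 K) K) → ℂ) b, finiteAdeleAddChar_mul_mem_schwartzBruhat K ι y f.2⟩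
  map_add' f g := Subtype.ext (funext fun b => by
    simp only [Submodule.coe_add, Pi.add_apply, mul_add])
  map_smul' c f := Subtype.ext (funext fun b => by
    simp only [Submodule.coe_smul, Pi.smul_apply, smul_eq_mul, RingHom.id_apply, mul_left_comm])

/-- `finModulateSB y f` as a function. [folklore] -/
@[simp] theorem coe_finModulateSB_apply (y : ι → FiniteAdeleRing (𝓞 K) K) (f : FinSB K ι) :
    ((finModulateSB K ι y f : FinSB K ι) : (ι → FiniteAdeleRing (𝓞 K) K) → ℂ) =
      fun b => (finiteAdeleAddChar K (∑ i, y i * b i) : ℂ) *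
        (f : (ι → FiniteAdeleRing (𝓞 K) K) → ℂ) b := rfl

omit [Fintype ι] in
/-- Adding a finite vector: `(0, k) + (a, b) = (a, k + b)` through the splitting. [folklore] -/
theorem piAdeleSplit_finVec_add (k : ι → FiniteAdeleRing (𝓞 K) K)
    (p : (ι → mixedSpace K) × (ι → FiniteAdeleRing (𝓞 K) K)) :
    piAdeleSplit K ι (0, k) + piAdeleSplit K ι p = piAdeleSplit K ι (p.1, k + p.2) := by
  rw [← map_add, Prod.mk_add_mk, zero_add]

omit [Fintype ι] in
/-- Every adelic vector is split: `v = split (v_∞, v_f)`. [folklore] -/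
theorem eq_piAdeleSplit (v : ι → AdeleRing (𝓞 K) K) :
    v = piAdeleSplit K ι (piArch K ι v, piFinite K ι v) := by
  rw [← piAdeleSplit_symm_apply, ContinuousAddEquiv.apply_symm_apply]

/-- The character at a finite vector: `ψ_K(Σ_i (0, y)_i (a, b)_i) = ψ_f(Σ_i y_i b_i)`. [folklore] -/
theorem adeleAddChar_sum_finVec_mul (y : ι → FiniteAdeleRing (𝓞 K) K)
    (p : (ι → mixedSpace K) × (ι → FiniteAdeleRing (𝓞 K) K)) :
    (adeleAddChar K (∑ i, piAdeleSplit K ι (0, y) i * piAdeleSplit K ι p i) : ℂ) =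
      (finiteAdeleAddChar K (∑ i, y i * p.2 i) : ℂ) := by
  rw [adeleAddChar_sum_mul_piAdeleSplit]
  simp only [piArch_piAdeleSplit, piFinite_piAdeleSplit, map_zero, neg_zero, AddChar.map_zero_eq_one,
    Circle.coe_one, one_mul]

variable {K ι}

/-- **Finite translations act on the finite factor**: `T_{(0,k)} (φ ⊗ f) = φ ⊗ f(k + ·)`. [folklore] -/
theorem translateLM_finVec_tmul (k : ι → FiniteAdeleRing (𝓞 K) K) (Φinf : 𝓢((ι → mixedSpace K), ℂ))
    (Φfin : FinSB K ι) :
    translateLM K ι (piAdeleSplit K ι (0, k)) (piSchwartzBruhatEquiv K ι (Φinf ⊗ₜ Φfin)) =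
      piSchwartzBruhatEquiv K ι (Φinf ⊗ₜ finTranslateSB K ι k Φfin) := by
  apply Subtype.ext
  rw [coe_translateLM_apply, coe_piSchwartzBruhatEquiv_tmul, coe_piSchwartzBruhatEquiv_tmul]
  funext v
  rw [eq_piAdeleSplit K ι v, piAdeleSplit_finVec_add]
  simp only [piArch_piAdeleSplit, piFinite_piAdeleSplit, coe_finTranslateSB_apply]

/-- **Finite modulations act on the finite factor**: `M_{(0,y)} (φ ⊗ f) = φ ⊗ ψ_f(Σ y_i ·_i) f`.
[folklore] -/
theorem modulateLM_finVec_tmul (y : ι → FiniteAdeleRing (𝓞 K) K) (Φinf : 𝓢((ι → mixedSpace K), ℂ))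
    (Φfin : FinSB K ι) :
    modulateLM K ι (piAdeleSplit K ι (0, y)) (piSchwartzBruhatEquiv K ι (Φinf ⊗ₜ Φfin)) =
      piSchwartzBruhatEquiv K ι (Φinf ⊗ₜ finModulateSB K ι y Φfin) := by
  apply Subtype.ext
  rw [coe_modulateLM_apply, coe_piSchwartzBruhatEquiv_tmul, coe_piSchwartzBruhatEquiv_tmul]
  funext v
  rw [eq_piAdeleSplit K ι v, adeleAddChar_sum_finVec_mul]
  simp only [piArch_piAdeleSplit, piFinite_piAdeleSplit, coe_finModulateSB_apply]
  ring

/-- `T_{(0,k)} = 1 ⊗ finTranslateSB k` on `𝒮(𝔸_K^ι) = 𝒮_∞ ⊗ 𝒮_f`. [folklore] -/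
theorem translateLM_finVec_eq_adelicTensorEnd (k : ι → FiniteAdeleRing (𝓞 K) K) :
    translateLM K ι (piAdeleSplit K ι (0, k)) = adelicTensorEnd LinearMap.id (finTranslateSB K ι k) :=
  linearMap_ext_tensor fun Φinf Φfin => by
    rw [translateLM_finVec_tmul, adelicTensorEnd_apply_tmul, LinearMap.id_apply]

/-- `M_{(0,y)} = 1 ⊗ finModulateSB y` on `𝒮(𝔸_K^ι) = 𝒮_∞ ⊗ 𝒮_f`. [folklore] -/
theorem modulateLM_finVec_eq_adelicTensorEnd (y : ι → FiniteAdeleRing (𝓞 K) K) :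
    modulateLM K ι (piAdeleSplit K ι (0, y)) = adelicTensorEnd LinearMap.id (finModulateSB K ι y) :=
  linearMap_ext_tensor fun Φinf Φfin => by
    rw [modulateLM_finVec_tmul, adelicTensorEnd_apply_tmul, LinearMap.id_apply]

end Operators

/-! ## 2. The archimedean slice `u ↦ (a ↦ u(a, b))` -/

section Slice

variable {K : Type} [Field K] [NumberField K] {ι : Type} [Fintype ι]

variable (K ι) in
/-- **The archimedean slice at a finite point `b`**: the linear map `𝒮(𝔸_K^ι) → 𝓢((K ⊗ ℝ)^ι)`,
`φ ⊗ f ↦ f(b) • φ`, i.e. `u ↦ (a ↦ u(a, b))` (`archSliceLM_apply_apply`). [folklore] -/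
def archSliceLM (b : ι → FiniteAdeleRing (𝓞 K) K) :
    ↥(piSchwartzBruhat K ι) →ₗ[ℂ] 𝓢((ι → mixedSpace K), ℂ) :=
  TensorProduct.lift
      (LinearMap.mk₂ ℂ
        (fun (Φinf : 𝓢((ι → mixedSpace K), ℂ)) (Φfin : FinSB K ι) =>
          ((Φfin : (ι → FiniteAdeleRing (𝓞 K) K) → ℂ) b) • Φinf)
        (fun _ _ _ => smul_add _ _ _)
        (fun _ _ _ => smul_comm _ _ _)
        (fun _ _ _ => by simp only [Submodule.coe_add, Pi.add_apply, add_smul])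
        (fun _ _ _ => by simp only [Submodule.coe_smul, Pi.smul_apply, smul_eq_mul, mul_smul])) ∘ₗ
    (piSchwartzBruhatEquiv K ι).symm.toLinearMap

/-- The slice of a pure tensor: `archSliceLM b (φ ⊗ f) = f(b) • φ`. [folklore] -/
theorem archSliceLM_tmul (b : ι → FiniteAdeleRing (𝓞 K) K) (Φinf : 𝓢((ι → mixedSpace K), ℂ))
    (Φfin : FinSB K ι) :
    archSliceLM K ι b (piSchwartzBruhatEquiv K ι (Φinf ⊗ₜ Φfin)) =
      ((Φfin : (ι → FiniteAdeleRing (𝓞 K) K) → ℂ) b) • Φinf := by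
  simp only [archSliceLM, LinearMap.comp_apply, LinearEquiv.coe_toLinearMap,
    LinearEquiv.symm_apply_apply, TensorProduct.lift.tmul, LinearMap.mk₂_apply]

/-- **The slice is evaluation**: `(archSliceLM b u)(a) = u(split (a, b))`. [folklore] -/
theorem archSliceLM_apply_apply (b : ι → FiniteAdeleRing (𝓞 K) K) (u : ↥(piSchwartzBruhat K ι))
    (a : ι → mixedSpace K) :
    archSliceLM K ι b u a = (u : (ι → AdeleRing (𝓞 K) K) → ℂ) (piAdeleSplit K ι (a, b)) := by
  let F₁ : ↥(piSchwartzBruhat K ι) →ₗ[ℂ] ℂ :=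
    { toFun := fun u => archSliceLM K ι b u a
      map_add' := fun u u' => by rw [map_add]; rfl
      map_smul' := fun c u => by rw [map_smul]; rfl }
  let F₂ : ↥(piSchwartzBruhat K ι) →ₗ[ℂ] ℂ :=
    { toFun := fun u => (u : (ι → AdeleRing (𝓞 K) K) → ℂ) (piAdeleSplit K ι (a, b))
      map_add' := fun _ _ => rfl
      map_smul' := fun _ _ => rfl }
  have h : F₁ = F₂ := linearMap_ext_tensor fun Φinf Φfin => by
    show archSliceLM K ι b (piSchwartzBruhatEquiv K ι (Φinf ⊗ₜ Φfin)) a =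
      ((piSchwartzBruhatEquiv K ι (Φinf ⊗ₜ Φfin) : ↥(piSchwartzBruhat K ι)) :
        (ι → AdeleRing (𝓞 K) K) → ℂ) (piAdeleSplit K ι (a, b))
    simp only [archSliceLM_tmul, coe_piSchwartzBruhatEquiv_tmul, piArch_piAdeleSplit, piFinite_piAdeleSplit,
      _root_.smul_apply, smul_eq_mul]
    ring
  exact LinearMap.congr_fun h u

end Slice

/-! ## 3. The dual box `L^♮`, orthogonality, and the sharp bi-annihilator `L^♮♮ = L` -/

section Duality

variable (K : Type) [Field K] [NumberField K] (ι : Type) [Fintype ι]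

attribute [local instance] secondCountableTopology_adeleRing locallyCompactSpace_adeleRing'
  secondCountableTopology_finiteAdeleRing locallyCompactSpace_finiteAdeleRing'

/-- **The dual box** of a subgroup `L ≤ (𝔸_K^∞)^ι` for Tate's finite character `ψ_f` and the pairing
`Σ_i y_i b_i`: `L^♮ = {y | ψ_f(Σ_i y_i b_i) = 1 for all b ∈ L}`. [folklore] -/
def dualBox (L : AddSubgroup (ι → FiniteAdeleRing (𝓞 K) K)) :
    AddSubgroup (ι → FiniteAdeleRing (𝓞 K) K) where
  carrier := {y | ∀ b ∈ L, finiteAdeleAddChar K (∑ i, y i * b i) = 1}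
  zero_mem' := fun b _ => by
    simp only [Pi.zero_apply, zero_mul, Finset.sum_const_zero, AddChar.map_zero_eq_one]
  add_mem' := fun {y y'} hy hy' b hb => by
    simp only [Pi.add_apply, add_mul, Finset.sum_add_distrib, AddChar.map_add_eq_mul, hy b hb, hy' b hb,
      mul_one]
  neg_mem' := fun {y} hy b hb => by
    simp only [Pi.neg_apply, neg_mul, Finset.sum_neg_distrib, AddChar.map_neg_eq_inv, hy b hb, inv_one]

variable {K ι}

/-- Membership in the dual box. [folklore] -/
theorem mem_dualBox_iff {L : AddSubgroup (ι → FiniteAdeleRing (𝓞 K) K)}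
    {y : ι → FiniteAdeleRing (𝓞 K) K} :
    y ∈ dualBox K ι L ↔ ∀ b ∈ L, finiteAdeleAddChar K (∑ i, y i * b i) = 1 := Iff.rfl

/-- `L ≤ L^♮♮` (the pairing is symmetric). [folklore] -/
theorem le_dualBox_dualBox (L : AddSubgroup (ι → FiniteAdeleRing (𝓞 K) K)) :
    L ≤ dualBox K ι (dualBox K ι L) := fun b hb y hy => by
  rw [show ∑ i, b i * y i = ∑ i, y i * b i from Finset.sum_congr rfl fun i _ => mul_comm _ _]
  exact hy b hb

/-- The dual box is closed. [folklore] -/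
theorem isClosed_dualBox (L : AddSubgroup (ι → FiniteAdeleRing (𝓞 K) K)) :
    IsClosed (dualBox K ι L : Set (ι → FiniteAdeleRing (𝓞 K) K)) := by
  have h : (dualBox K ι L : Set (ι → FiniteAdeleRing (𝓞 K) K)) =
      ⋂ b ∈ L, {y | (finiteAdeleAddChar K (∑ i, y i * b i) : ℂ) = 1} := by
    ext y
    simp only [SetLike.mem_coe, mem_dualBox_iff, Set.mem_iInter, Set.mem_setOf_eq, Circle.coe_eq_one]
  rw [h]
  refine isClosed_biInter fun b _ => isClosed_eq ?_ continuous_const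
  exact continuous_subtype_val.comp ((continuous_finiteAdeleAddChar K).comp
    (continuous_finsetSum _ fun i _ => (continuous_apply i).mul continuous_const))

/-- **Orthogonality on a subgroup**: for a measurable subgroup `L` and a right-invariant measure `μ`,
`∫ 𝟙_L(b) ψ_f(Σ_i y_i b_i) dμ(b) = μ(L) · 𝟙_{L^♮}(y)` (shift by an element of `L` on which the character is
non-trivial). [cite: CasselsFrohlichANT1967, Ch. XV Lemma 4.2.3] -/
theorem finitePiFourier_indicator_addSubgroup [MeasurableSpace (FiniteAdeleRing (𝓞 K) K)]
    [BorelSpace (FiniteAdeleRing (𝓞 K) K)] (μ : Measure (ι → FiniteAdeleRing (𝓞 K) K))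
    [μ.IsAddRightInvariant] (L : AddSubgroup (ι → FiniteAdeleRing (𝓞 K) K))
    (hL : MeasurableSet (L : Set (ι → FiniteAdeleRing (𝓞 K) K))) (y : ι → FiniteAdeleRing (𝓞 K) K) :
    finitePiFourier K μ ((L : Set (ι → FiniteAdeleRing (𝓞 K) K)).indicator fun _ => (1 : ℂ)) y =
      (μ.real (L : Set (ι → FiniteAdeleRing (𝓞 K) K)) : ℂ) *
        (dualBox K ι L : Set (ι → FiniteAdeleRing (𝓞 K) K)).indicator (fun _ => (1 : ℂ)) y := by
  haveI : BorelSpace (ι → FiniteAdeleRing (𝓞 K) K) := Pi.borelSpace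
  rw [finitePiFourier_apply]
  by_cases hy : y ∈ dualBox K ι L
  · have h1 : (fun b : ι → FiniteAdeleRing (𝓞 K) K =>
        (L : Set (ι → FiniteAdeleRing (𝓞 K) K)).indicator (fun _ => (1 : ℂ)) b *
          (finiteAdeleAddChar K (∑ i, y i * b i) : ℂ)) =
        (L : Set (ι → FiniteAdeleRing (𝓞 K) K)).indicator fun _ => (1 : ℂ) := by
      funext b
      by_cases hb : b ∈ L
      · rw [Set.indicator_of_mem (show b ∈ (L : Set _) from hb), hy b hb, Circle.coe_one, one_mul]
      · rw [Set.indicator_of_notMem (show b ∉ (L : Set _) from hb), zero_mul]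
    rw [h1, integral_indicator_const _ hL, Set.indicator_of_mem (show y ∈ (dualBox K ι L : Set _) from hy),
      Complex.real_smul, mul_one]
  · obtain ⟨b₀, hb₀, hne⟩ : ∃ b₀ ∈ L, finiteAdeleAddChar K (∑ i, y i * b₀ i) ≠ 1 := by
      by_contra h
      push Not at h
      exact hy h
    rw [Set.indicator_of_notMem (show y ∉ (dualBox K ι L : Set _) from hy), mul_zero]
    set F : (ι → FiniteAdeleRing (𝓞 K) K) → ℂ := fun b =>
      (L : Set (ι → FiniteAdeleRing (𝓞 K) K)).indicator (fun _ => (1 : ℂ)) b *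
        (finiteAdeleAddChar K (∑ i, y i * b i) : ℂ) with hF
    have hshift : ∫ b, F b ∂μ = (finiteAdeleAddChar K (∑ i, y i * b₀ i) : ℂ) * ∫ b, F b ∂μ := by
      rw [← integral_const_mul, ← integral_add_right_eq_self F b₀]
      refine integral_congr_ae (Filter.Eventually.of_forall fun b => ?_)
      have hind : (L : Set (ι → FiniteAdeleRing (𝓞 K) K)).indicator (fun _ => (1 : ℂ)) (b + b₀) =
          (L : Set (ι → FiniteAdeleRing (𝓞 K) K)).indicator (fun _ => (1 : ℂ)) b := by
        by_cases hb : b ∈ L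
        · rw [Set.indicator_of_mem (show b + b₀ ∈ (L : Set _) from L.add_mem hb hb₀),
            Set.indicator_of_mem (show b ∈ (L : Set _) from hb)]
        · have hb' : b + b₀ ∉ L := fun h => hb (by simpa using L.sub_mem h hb₀)
          rw [Set.indicator_of_notMem (show b + b₀ ∉ (L : Set _) from hb'),
            Set.indicator_of_notMem (show b ∉ (L : Set _) from hb)]
      simp only [hF, Pi.add_apply, mul_add, Finset.sum_add_distrib, AddChar.map_add_eq_mul, Circle.coe_mul,
        hind]
      ring
    have hzero : (1 - (finiteAdeleAddChar K (∑ i, y i * b₀ i) : ℂ)) * ∫ b, F b ∂μ = 0 := by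
      rw [sub_mul, one_mul, ← hshift, sub_self]
    rcases mul_eq_zero.1 hzero with h | h
    · exact absurd (Circle.coe_eq_one.1 (sub_eq_zero.1 h).symm) hne
    · exact h

/-- **The adelic transform of a split product** `v ↦ Φ_∞(v_∞) Φ_f(v_f)` (arbitrary factors): with
`ν = c · split_*(μ_∞ ⊗ μ_f)`,
`𝓕(Φ_∞ ⊗ Φ_f)(η) = c · (∫ e(-⟨a, η_∞⟩) Φ_∞(a) dμ_∞(a)) · 𝓕_f Φ_f (η_f)` (Fubini for products).
[folklore] -/
theorem adelicPiFourier_split_mul [MeasurableSpace (AdeleRing (𝓞 K) K)] [BorelSpace (AdeleRing (𝓞 K) K)]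
    [MeasurableSpace (FiniteAdeleRing (𝓞 K) K)] [BorelSpace (FiniteAdeleRing (𝓞 K) K)]
    (ν : Measure (ι → AdeleRing (𝓞 K) K)) (Φinf : (ι → mixedSpace K) → ℂ)
    (Φfin : (ι → FiniteAdeleRing (𝓞 K) K) → ℂ) {μE : Measure (ι → mixedSpace K)} [SFinite μE]
    {μf : Measure (ι → FiniteAdeleRing (𝓞 K) K)} [SFinite μf] {c : ℝ≥0}
    (hν : ν = c • (μE.prod μf).map (piAdeleSplit K ι)) (η : ι → AdeleRing (𝓞 K) K) :
    adelicPiFourier K ι ν (fun v => Φinf (piArch K ι v) * Φfin (piFinite K ι v)) η =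
      (c : ℂ) * (∫ a, (𝐞 (-(piTracePairing K ι a (piArch K ι η))) : ℂ) * Φinf a ∂μE) *
        finitePiFourier K μf Φfin (piFinite K ι η) := by
  rw [adelicPiFourier_apply, integral_eq_smul_integral_prod hν, finitePiFourier_apply]
  have hint : (fun p : (ι → mixedSpace K) × (ι → FiniteAdeleRing (𝓞 K) K) =>
      Φinf (piArch K ι (piAdeleSplit K ι p)) * Φfin (piFinite K ι (piAdeleSplit K ι p)) *
        (adeleAddChar K (∑ i, η i * piAdeleSplit K ι p i) : ℂ)) =
      fun p => ((𝐞 (-(piTracePairing K ι p.1 (piArch K ι η))) : ℂ) * Φinf p.1) *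
        (Φfin p.2 * (finiteAdeleAddChar K (∑ i, piFinite K ι η i * p.2 i) : ℂ)) := by
    funext p
    rw [piArch_piAdeleSplit, piFinite_piAdeleSplit, adeleAddChar_sum_mul_piAdeleSplit]
    ring
  rw [hint, integral_prod_mul (fun a : ι → mixedSpace K =>
      ((𝐞 (-(piTracePairing K ι a (piArch K ι η))) : ℂ) * Φinf a))
    (fun b : ι → FiniteAdeleRing (𝓞 K) K =>
      Φfin b * (finiteAdeleAddChar K (∑ i, piFinite K ι η i * b i) : ℂ)),
    Complex.real_smul, mul_assoc]

omit [Fintype ι] in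
/-- The indicator of a compact open subgroup of `(𝔸_K^∞)^ι` is Schwartz–Bruhat. [folklore] -/
theorem indicator_addSubgroup_mem_schwartzBruhat (L : AddSubgroup (ι → FiniteAdeleRing (𝓞 K) K))
    (hLo : IsOpen (L : Set (ι → FiniteAdeleRing (𝓞 K) K)))
    (hLc : IsCompact (L : Set (ι → FiniteAdeleRing (𝓞 K) K))) (c : ℂ) :
    (L : Set (ι → FiniteAdeleRing (𝓞 K) K)).indicator (fun _ => c) ∈
      SchwartzBruhat (ι → FiniteAdeleRing (𝓞 K) K) :=
  indicator_const_mem_schwartzBruhat hLo (L.isClosed_of_isOpen hLo) hLc c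

/-- **The sharp bi-annihilator**: for a compact open subgroup `L ≤ (𝔸_K^∞)^ι`, `(L^♮)^♮ = L`.
Proof by adelic Fourier inversion (Tate Thm. 4.1.2, `adelicPiFourier_adelicPiFourier`) applied to
`φ₀ ⊗ 𝟙_L` and orthogonality (`finitePiFourier_indicator_addSubgroup`) for `L` and for `L^♮`: the double
transform is a multiple of `(…) ⊗ 𝟙_{L^♮♮}` and equals `ν(D^ι)² (φ₀ ⊗ 𝟙_L)(-·)`; compare finite factors.
[cite: CasselsFrohlichANT1967, Ch. XV Thm. 4.1.2] -/
theorem dualBox_dualBox_eq (L : AddSubgroup (ι → FiniteAdeleRing (𝓞 K) K))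
    (hLo : IsOpen (L : Set (ι → FiniteAdeleRing (𝓞 K) K)))
    (hLc : IsCompact (L : Set (ι → FiniteAdeleRing (𝓞 K) K))) :
    dualBox K ι (dualBox K ι L) = L := by
  refine le_antisymm (fun b hb => ?_) (le_dualBox_dualBox L)
  by_contra hbL
  -- measures
  letI : MeasurableSpace (AdeleRing (𝓞 K) K) := borel _
  haveI : BorelSpace (AdeleRing (𝓞 K) K) := ⟨rfl⟩
  letI : MeasurableSpace (FiniteAdeleRing (𝓞 K) K) := borel _
  haveI : BorelSpace (FiniteAdeleRing (𝓞 K) K) := ⟨rfl⟩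
  haveI : BorelSpace (ι → FiniteAdeleRing (𝓞 K) K) := Pi.borelSpace
  haveI : BorelSpace (ι → mixedSpace K) := Pi.borelSpace
  haveI : BorelSpace (ι → AdeleRing (𝓞 K) K) := Pi.borelSpace
  set μE : Measure (ι → mixedSpace K) := Measure.addHaar with hμE
  set μf : Measure (ι → FiniteAdeleRing (𝓞 K) K) := Measure.addHaar with hμf
  set ν : Measure (ι → AdeleRing (𝓞 K) K) := Measure.addHaar with hν_def
  obtain ⟨c, -, hν⟩ := exists_haar_eq_smul_map_prod K ι ν μE μf
  -- an archimedean Schwartz function with `φ₀ 0 = 1`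
  obtain ⟨f, -, hfc, hfd, -, hf0⟩ := exists_contDiff_tsupport_subset (E := ι → mixedSpace K)
    (n := (⊤ : ℕ∞)) (s := Set.univ) (x := (0 : ι → mixedSpace K)) Filter.univ_mem
  have hgc : HasCompactSupport fun a : ι → mixedSpace K => ((f a : ℝ) : ℂ) :=
    hfc.comp_left Complex.ofReal_zero
  have hgd : ContDiff ℝ ∞ fun a : ι → mixedSpace K => ((f a : ℝ) : ℂ) :=
    Complex.ofRealCLM.contDiff.comp hfd
  set φ₀ : 𝓢((ι → mixedSpace K), ℂ) := hgc.toSchwartzMap hgd with hφ₀_def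
  have hφ₀ : φ₀ 0 = 1 := by
    show ((f 0 : ℝ) : ℂ) = 1
    rw [hf0, Complex.ofReal_one]
  -- the test function `Φ = φ₀ ⊗ 𝟙_L`
  set χL : (ι → FiniteAdeleRing (𝓞 K) K) → ℂ :=
    (L : Set (ι → FiniteAdeleRing (𝓞 K) K)).indicator fun _ => (1 : ℂ) with hχL
  set L' : AddSubgroup (ι → FiniteAdeleRing (𝓞 K) K) := dualBox K ι L with hL'
  set χL' : (ι → FiniteAdeleRing (𝓞 K) K) → ℂ :=
    (L' : Set (ι → FiniteAdeleRing (𝓞 K) K)).indicator fun _ => (1 : ℂ) with hχL'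
  set χL'' : (ι → FiniteAdeleRing (𝓞 K) K) → ℂ :=
    (dualBox K ι L' : Set (ι → FiniteAdeleRing (𝓞 K) K)).indicator fun _ => (1 : ℂ) with hχL''
  set Φ : (ι → AdeleRing (𝓞 K) K) → ℂ := fun v => φ₀ (piArch K ι v) * χL (piFinite K ι v) with hΦ_def
  have hΦ : Φ ∈ piSchwartzBruhat K ι :=
    tensor_mem_piSchwartzBruhat φ₀ (indicator_addSubgroup_mem_schwartzBruhat L hLo hLc 1)
  have hLm : MeasurableSet (L : Set (ι → FiniteAdeleRing (𝓞 K) K)) := hLo.measurableSet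
  have hL'm : MeasurableSet (L' : Set (ι → FiniteAdeleRing (𝓞 K) K)) :=
    (isClosed_dualBox L).measurableSet
  -- first transform: `𝓕Φ = Ψ_∞ ⊗ (μ(L) 𝟙_{L'})`
  set I : (ι → mixedSpace K) → ℂ := fun a' =>
    ∫ a, (𝐞 (-(piTracePairing K ι a a')) : ℂ) * φ₀ a ∂μE with hI
  set Ψinf : (ι → mixedSpace K) → ℂ := fun a' => (c : ℂ) * I a' with hΨinf
  set Ψfin : (ι → FiniteAdeleRing (𝓞 K) K) → ℂ := fun z =>
    (μf.real (L : Set (ι → FiniteAdeleRing (𝓞 K) K)) : ℂ) * χL' z with hΨfin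
  have h1 : adelicPiFourier K ι ν Φ = fun η => Ψinf (piArch K ι η) * Ψfin (piFinite K ι η) := by
    funext η
    rw [hΦ_def, adelicPiFourier_split_mul ν (fun a => φ₀ a) χL hν η, hχL,
      finitePiFourier_indicator_addSubgroup μf L hLm]
  -- second transform
  have h2 : ∀ z : ι → FiniteAdeleRing (𝓞 K) K, finitePiFourier K μf Ψfin z =
      (μf.real (L : Set (ι → FiniteAdeleRing (𝓞 K) K)) : ℂ) *
        ((μf.real (L' : Set (ι → FiniteAdeleRing (𝓞 K) K)) : ℂ) * χL'' z) := by
    intro z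
    rw [hΨfin, show (fun z => (μf.real (L : Set (ι → FiniteAdeleRing (𝓞 K) K)) : ℂ) * χL' z) =
        (μf.real (L : Set (ι → FiniteAdeleRing (𝓞 K) K)) : ℂ) • χL' from rfl, finitePiFourier_smul, hχL',
      finitePiFourier_indicator_addSubgroup μf L' hL'm]
  set X : ℂ := (c : ℂ) * (∫ a, (𝐞 (-(piTracePairing K ι a 0)) : ℂ) * Ψinf a ∂μE) *
    ((μf.real (L : Set (ι → FiniteAdeleRing (𝓞 K) K)) : ℂ) *
      (μf.real (L' : Set (ι → FiniteAdeleRing (𝓞 K) K)) : ℂ)) with hX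
  have h3 : ∀ z : ι → FiniteAdeleRing (𝓞 K) K,
      adelicPiFourier K ι ν (adelicPiFourier K ι ν Φ) (piAdeleSplit K ι (0, z)) = X * χL'' z := by
    intro z
    rw [h1, adelicPiFourier_split_mul ν Ψinf Ψfin hν, piArch_piAdeleSplit, piFinite_piAdeleSplit, h2, hX]
    ring
  -- inversion
  set D2 : ℂ := (((ν (piFundamentalDomain K ι)).toReal ^ 2 : ℝ) : ℂ) with hD2
  have hD2ne : D2 ≠ 0 :=
    Complex.ofReal_ne_zero.2 (pow_ne_zero 2 (Weil1964.measure_piFundamentalDomain_toReal_pos (ν := ν)).ne')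
  have h4 : ∀ z : ι → FiniteAdeleRing (𝓞 K) K,
      adelicPiFourier K ι ν (adelicPiFourier K ι ν Φ) (piAdeleSplit K ι (0, z)) = D2 * χL z := by
    intro z
    rw [adelicPiFourier_adelicPiFourier ν hΦ, hΦ_def]
    dsimp only
    rw [piArch_neg, piFinite_neg, piArch_piAdeleSplit, piFinite_piAdeleSplit, neg_zero, hφ₀, one_mul, hχL,
      hD2]
    congr 1
    by_cases hz : z ∈ L
    · rw [Set.indicator_of_mem (show -z ∈ (L : Set _) from L.neg_mem hz),
        Set.indicator_of_mem (show z ∈ (L : Set _) from hz)]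
    · rw [Set.indicator_of_notMem (show -z ∉ (L : Set _) from fun h => hz (by simpa using L.neg_mem h)),
        Set.indicator_of_notMem (show z ∉ (L : Set _) from hz)]
  -- compare at `z = 0` and at `z = b`
  have h0 : X = D2 := by
    have := (h3 0).symm.trans (h4 0)
    rwa [hχL'', hχL, Set.indicator_of_mem (show (0 : ι → FiniteAdeleRing (𝓞 K) K) ∈
        (dualBox K ι L' : Set _) from (dualBox K ι L').zero_mem),
      Set.indicator_of_mem (show (0 : ι → FiniteAdeleRing (𝓞 K) K) ∈ (L : Set _) from L.zero_mem),
      mul_one, mul_one] at this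
  have hb' := (h3 b).symm.trans (h4 b)
  rw [hχL'', hχL, Set.indicator_of_mem (show b ∈ (dualBox K ι L' : Set _) from hb),
    Set.indicator_of_notMem (show b ∉ (L : Set _) from hbL), mul_one, mul_zero, h0] at hb'
  exact hD2ne hb'

/-- The bi-annihilator, pointwise: `b ∈ L` iff `ψ_f(Σ_i y_i b_i) = 1` for every `y ∈ L^♮`. [folklore] -/
theorem mem_iff_forall_dualBox (L : AddSubgroup (ι → FiniteAdeleRing (𝓞 K) K))
    (hLo : IsOpen (L : Set (ι → FiniteAdeleRing (𝓞 K) K)))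
    (hLc : IsCompact (L : Set (ι → FiniteAdeleRing (𝓞 K) K))) (b : ι → FiniteAdeleRing (𝓞 K) K) :
    b ∈ L ↔ ∀ y ∈ dualBox K ι L, finiteAdeleAddChar K (∑ i, y i * b i) = 1 := by
  constructor
  · intro hb y hy
    exact hy b hb
  · intro h
    rw [← dualBox_dualBox_eq L hLo hLc]
    intro y hy
    rw [show ∑ i, b i * y i = ∑ i, y i * b i from Finset.sum_congr rfl fun i _ => mul_comm _ _]
    exact h y hy

end Duality

/-! ## 4. The fixed-vector lemma -/

section FixedVector

variable {K : Type} [Field K] [NumberField K] {ι : Type} [Fintype ι]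

/-- **Fixed-vector lemma (pointwise)**: if `u ∈ 𝒮(𝔸_K^ι)` is fixed by the finite translations by a compact
open subgroup `L` and by the finite modulations by `L^♮`, then `u(a, b) = u(a, 0) 𝟙_L(b)`. [folklore] -/
theorem coe_eq_of_fixed (L : AddSubgroup (ι → FiniteAdeleRing (𝓞 K) K))
    (hLo : IsOpen (L : Set (ι → FiniteAdeleRing (𝓞 K) K)))
    (hLc : IsCompact (L : Set (ι → FiniteAdeleRing (𝓞 K) K))) {u : ↥(piSchwartzBruhat K ι)}
    (hT : ∀ k ∈ L, translateLM K ι (piAdeleSplit K ι (0, k)) u = u)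
    (hM : ∀ y ∈ dualBox K ι L, modulateLM K ι (piAdeleSplit K ι (0, y)) u = u) :
    (u : (ι → AdeleRing (𝓞 K) K) → ℂ) = fun v =>
      archSliceLM K ι 0 u (piArch K ι v) *
        (L : Set (ι → FiniteAdeleRing (𝓞 K) K)).indicator (fun _ => (1 : ℂ)) (piFinite K ι v) := by
  funext v
  rw [archSliceLM_apply_apply]
  set a := piArch K ι v with ha
  set b := piFinite K ι v with hb
  have hv : v = piAdeleSplit K ι (a, b) := eq_piAdeleSplit K ι v
  by_cases hbL : b ∈ L
  · -- translate by `b`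
    have h := congrArg (fun w : ↥(piSchwartzBruhat K ι) => (w : (ι → AdeleRing (𝓞 K) K) → ℂ)
      (piAdeleSplit K ι (a, 0))) (hT b hbL)
    simp only [coe_translateLM_apply] at h
    rw [piAdeleSplit_finVec_add, add_zero] at h
    rw [Set.indicator_of_mem (show b ∈ (L : Set _) from hbL), mul_one, hv, ← h]
  · -- modulate by a `y ∈ L^♮` on which `b` is not annihilated
    obtain ⟨y, hy, hne⟩ : ∃ y ∈ dualBox K ι L, finiteAdeleAddChar K (∑ i, y i * b i) ≠ 1 := by
      by_contra h
      push Not at h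
      exact hbL ((mem_iff_forall_dualBox L hLo hLc b).2 h)
    have h := congrArg (fun w : ↥(piSchwartzBruhat K ι) => (w : (ι → AdeleRing (𝓞 K) K) → ℂ)
      (piAdeleSplit K ι (a, b))) (hM y hy)
    simp only [coe_modulateLM_apply] at h
    rw [adeleAddChar_sum_finVec_mul] at h
    rw [Set.indicator_of_notMem (show b ∉ (L : Set _) from hbL), mul_zero, hv]
    have h' : ((finiteAdeleAddChar K (∑ i, y i * b i) : ℂ) - 1) *
        (u : (ι → AdeleRing (𝓞 K) K) → ℂ) (piAdeleSplit K ι (a, b)) = 0 := by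
      rw [sub_mul, one_mul, h, sub_self]
    rcases mul_eq_zero.1 h' with h'' | h''
    · exact absurd (Circle.coe_eq_one.1 (sub_eq_zero.1 h'')) hne
    · exact h''

/-- **Fixed-vector lemma**: a vector of `𝒮(𝔸_K^ι)` fixed by the finite translations by a compact open
subgroup `L` and by the finite modulations by `L^♮` is the pure tensor `u(·, 0) ⊗ 𝟙_L`. [folklore] -/
theorem eq_tmul_indicator_of_fixed (L : AddSubgroup (ι → FiniteAdeleRing (𝓞 K) K))
    (hLo : IsOpen (L : Set (ι → FiniteAdeleRing (𝓞 K) K)))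
    (hLc : IsCompact (L : Set (ι → FiniteAdeleRing (𝓞 K) K))) {u : ↥(piSchwartzBruhat K ι)}
    (hT : ∀ k ∈ L, translateLM K ι (piAdeleSplit K ι (0, k)) u = u)
    (hM : ∀ y ∈ dualBox K ι L, modulateLM K ι (piAdeleSplit K ι (0, y)) u = u) :
    u = piSchwartzBruhatEquiv K ι (archSliceLM K ι 0 u ⊗ₜ
      ⟨(L : Set (ι → FiniteAdeleRing (𝓞 K) K)).indicator fun _ => (1 : ℂ),
        indicator_addSubgroup_mem_schwartzBruhat L hLo hLc 1⟩) := by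
  apply Subtype.ext
  rw [coe_piSchwartzBruhatEquiv_tmul]
  exact coe_eq_of_fixed L hLo hLc hT hM

end FixedVector

/-! ## 5. Stripping: `M (φ ⊗ 𝟙_{x₀ + L}) = (archFactor M L φ) ⊗ 𝟙_{x₀ + L}` -/

section Stripping

variable {K : Type} [Field K] [NumberField K] {ι : Type} [Fintype ι]

variable (K ι) in
/-- The indicator `𝟙_L` of a compact open subgroup as an element of `𝒮((𝔸_K^∞)^ι)`. [folklore] -/
def indicatorSB (L : AddSubgroup (ι → FiniteAdeleRing (𝓞 K) K))
    (hLo : IsOpen (L : Set (ι → FiniteAdeleRing (𝓞 K) K)))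
    (hLc : IsCompact (L : Set (ι → FiniteAdeleRing (𝓞 K) K))) : FinSB K ι :=
  ⟨(L : Set (ι → FiniteAdeleRing (𝓞 K) K)).indicator fun _ => (1 : ℂ),
    indicator_addSubgroup_mem_schwartzBruhat L hLo hLc 1⟩

omit [Fintype ι] in
/-- `indicatorSB L` as a function. [folklore] -/
@[simp] theorem coe_indicatorSB (L : AddSubgroup (ι → FiniteAdeleRing (𝓞 K) K))
    (hLo : IsOpen (L : Set (ι → FiniteAdeleRing (𝓞 K) K)))
    (hLc : IsCompact (L : Set (ι → FiniteAdeleRing (𝓞 K) K))) :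
    ((indicatorSB K ι L hLo hLc : FinSB K ι) : (ι → FiniteAdeleRing (𝓞 K) K) → ℂ) =
      (L : Set (ι → FiniteAdeleRing (𝓞 K) K)).indicator fun _ => (1 : ℂ) := rfl

omit [Fintype ι] in
/-- `𝟙_L` is invariant under the finite translations by `L`. [folklore] -/
theorem finTranslateSB_indicatorSB_of_mem (L : AddSubgroup (ι → FiniteAdeleRing (𝓞 K) K))
    (hLo : IsOpen (L : Set (ι → FiniteAdeleRing (𝓞 K) K)))
    (hLc : IsCompact (L : Set (ι → FiniteAdeleRing (𝓞 K) K))) {k : ι → FiniteAdeleRing (𝓞 K) K}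
    (hk : k ∈ L) : finTranslateSB K ι k (indicatorSB K ι L hLo hLc) = indicatorSB K ι L hLo hLc := by
  apply Subtype.ext
  rw [coe_finTranslateSB_apply, coe_indicatorSB]
  funext b
  by_cases hb : b ∈ L
  · rw [Set.indicator_of_mem (show k + b ∈ (L : Set _) from L.add_mem hk hb),
      Set.indicator_of_mem (show b ∈ (L : Set _) from hb)]
  · have hkb : k + b ∉ L := fun h => hb (by simpa using L.sub_mem h hk)
    rw [Set.indicator_of_notMem (show k + b ∉ (L : Set _) from hkb),
      Set.indicator_of_notMem (show b ∉ (L : Set _) from hb)]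

/-- `𝟙_L` is invariant under the finite modulations by `L^♮`. [folklore] -/
theorem finModulateSB_indicatorSB_of_mem (L : AddSubgroup (ι → FiniteAdeleRing (𝓞 K) K))
    (hLo : IsOpen (L : Set (ι → FiniteAdeleRing (𝓞 K) K)))
    (hLc : IsCompact (L : Set (ι → FiniteAdeleRing (𝓞 K) K))) {y : ι → FiniteAdeleRing (𝓞 K) K}
    (hy : y ∈ dualBox K ι L) : finModulateSB K ι y (indicatorSB K ι L hLo hLc) = indicatorSB K ι L hLo hLc := by
  apply Subtype.ext
  rw [coe_finModulateSB_apply, coe_indicatorSB]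
  funext b
  by_cases hb : b ∈ L
  · rw [Set.indicator_of_mem (show b ∈ (L : Set _) from hb), hy b hb, Circle.coe_one, one_mul]
  · rw [Set.indicator_of_notMem (show b ∉ (L : Set _) from hb), mul_zero]

variable (M : ↥(piSchwartzBruhat K ι) →ₗ[ℂ] ↥(piSchwartzBruhat K ι))

/-- **The archimedean factor of `M` at the compact open subgroup `L`**: `φ ↦ (M (φ ⊗ 𝟙_L))(·, 0)`.
[folklore] -/
def archFactor (L : AddSubgroup (ι → FiniteAdeleRing (𝓞 K) K))
    (hLo : IsOpen (L : Set (ι → FiniteAdeleRing (𝓞 K) K)))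
    (hLc : IsCompact (L : Set (ι → FiniteAdeleRing (𝓞 K) K))) :
    𝓢((ι → mixedSpace K), ℂ) →ₗ[ℂ] 𝓢((ι → mixedSpace K), ℂ) :=
  archSliceLM K ι 0 ∘ₗ M ∘ₗ (piSchwartzBruhatEquiv K ι).toLinearMap ∘ₗ
    (TensorProduct.mk ℂ 𝓢((ι → mixedSpace K), ℂ) (FinSB K ι)).flip (indicatorSB K ι L hLo hLc)

/-- Unfolding of `archFactor`. [folklore] -/
theorem archFactor_apply (L : AddSubgroup (ι → FiniteAdeleRing (𝓞 K) K))
    (hLo : IsOpen (L : Set (ι → FiniteAdeleRing (𝓞 K) K)))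
    (hLc : IsCompact (L : Set (ι → FiniteAdeleRing (𝓞 K) K))) (Φinf : 𝓢((ι → mixedSpace K), ℂ)) :
    archFactor M L hLo hLc Φinf =
      archSliceLM K ι 0 (M (piSchwartzBruhatEquiv K ι (Φinf ⊗ₜ indicatorSB K ι L hLo hLc))) := rfl

/-- **Stripping on `φ ⊗ 𝟙_L`**: if `M` commutes with the finite translations by `L` and the finite
modulations by `L^♮`, then `M (φ ⊗ 𝟙_L) = (archFactor M L φ) ⊗ 𝟙_L`. [folklore] -/
theorem map_tmul_indicatorSB (L : AddSubgroup (ι → FiniteAdeleRing (𝓞 K) K))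
    (hLo : IsOpen (L : Set (ι → FiniteAdeleRing (𝓞 K) K)))
    (hLc : IsCompact (L : Set (ι → FiniteAdeleRing (𝓞 K) K)))
    (hT : ∀ k ∈ L, M ∘ₗ translateLM K ι (piAdeleSplit K ι (0, k)) =
      translateLM K ι (piAdeleSplit K ι (0, k)) ∘ₗ M)
    (hM : ∀ y ∈ dualBox K ι L, M ∘ₗ modulateLM K ι (piAdeleSplit K ι (0, y)) =
      modulateLM K ι (piAdeleSplit K ι (0, y)) ∘ₗ M)
    (Φinf : 𝓢((ι → mixedSpace K), ℂ)) :
    M (piSchwartzBruhatEquiv K ι (Φinf ⊗ₜ indicatorSB K ι L hLo hLc)) =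
      piSchwartzBruhatEquiv K ι (archFactor M L hLo hLc Φinf ⊗ₜ indicatorSB K ι L hLo hLc) := by
  set u := M (piSchwartzBruhatEquiv K ι (Φinf ⊗ₜ indicatorSB K ι L hLo hLc)) with hu
  have hTu : ∀ k ∈ L, translateLM K ι (piAdeleSplit K ι (0, k)) u = u := fun k hk => by
    rw [hu, ← LinearMap.comp_apply, ← hT k hk, LinearMap.comp_apply, translateLM_finVec_tmul,
      finTranslateSB_indicatorSB_of_mem L hLo hLc hk]
  have hMu : ∀ y ∈ dualBox K ι L, modulateLM K ι (piAdeleSplit K ι (0, y)) u = u := fun y hy => by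
    rw [hu, ← LinearMap.comp_apply, ← hM y hy, LinearMap.comp_apply, modulateLM_finVec_tmul,
      finModulateSB_indicatorSB_of_mem L hLo hLc hy]
  rw [archFactor_apply, ← hu]
  exact eq_tmul_indicator_of_fixed L hLo hLc hTu hMu

/-- **Stripping on translated boxes**: if `M` commutes with all finite translations and with the finite
modulations by `L^♮`, then `M (φ ⊗ 𝟙_L(k + ·)) = (archFactor M L φ) ⊗ 𝟙_L(k + ·)` — the same archimedean
factor serves every coset `-k + L`. [folklore] -/
theorem map_tmul_finTranslateSB_indicatorSB (L : AddSubgroup (ι → FiniteAdeleRing (𝓞 K) K))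
    (hLo : IsOpen (L : Set (ι → FiniteAdeleRing (𝓞 K) K)))
    (hLc : IsCompact (L : Set (ι → FiniteAdeleRing (𝓞 K) K)))
    (hT : ∀ k, M ∘ₗ translateLM K ι (piAdeleSplit K ι (0, k)) =
      translateLM K ι (piAdeleSplit K ι (0, k)) ∘ₗ M)
    (hM : ∀ y ∈ dualBox K ι L, M ∘ₗ modulateLM K ι (piAdeleSplit K ι (0, y)) =
      modulateLM K ι (piAdeleSplit K ι (0, y)) ∘ₗ M)
    (Φinf : 𝓢((ι → mixedSpace K), ℂ)) (k : ι → FiniteAdeleRing (𝓞 K) K) :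
    M (piSchwartzBruhatEquiv K ι (Φinf ⊗ₜ finTranslateSB K ι k (indicatorSB K ι L hLo hLc))) =
      piSchwartzBruhatEquiv K ι
        (archFactor M L hLo hLc Φinf ⊗ₜ finTranslateSB K ι k (indicatorSB K ι L hLo hLc)) := by
  rw [← translateLM_finVec_tmul, ← LinearMap.comp_apply, hT k, LinearMap.comp_apply,
    map_tmul_indicatorSB M L hLo hLc (fun k _ => hT k) hM, translateLM_finVec_tmul]

/-- The thin-coset test function `Φ_∞ ⊗ 𝟙_{x₀ + (𝔫𝒪̂)^ι}` of `SchwartzBruhatCosetIndicator` is the pure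
tensor `Φ_∞ ⊗ 𝟙_{(𝔫𝒪̂)^ι}(-x₀ + ·)`. [folklore] -/
theorem thinCosetTestFunₗ_eq_tmul (x₀ : ι → FiniteAdeleRing (𝓞 K) K) (𝔫 : Ideal (𝓞 K))
    (Φinf : 𝓢((ι → mixedSpace K), ℂ)) :
    thinCosetTestFunₗ (K := K) (ι := ι) x₀ 𝔫 Φinf =
      piSchwartzBruhatEquiv K ι (Φinf ⊗ₜ finTranslateSB K ι (-x₀)
        (indicatorSB K ι (piLevelIdeal K ι 𝔫) (isOpen_piLevelIdeal K 𝔫) (isCompact_piLevelIdeal K ι 𝔫))) := by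
  apply Subtype.ext
  rw [coe_thinCosetTestFunₗ, coe_piSchwartzBruhatEquiv_tmul]
  funext v
  rw [thinCosetTestFun_apply]
  simp only [coe_finTranslateSB_apply, coe_indicatorSB]
  by_cases hv : -x₀ + piFinite K ι v ∈ piLevelIdeal K ι 𝔫
  · rw [if_pos hv, Set.indicator_of_mem (show -x₀ + piFinite K ι v ∈ (piLevelIdeal K ι 𝔫 : Set _) from hv),
      mul_one]
  · rw [if_neg hv,
      Set.indicator_of_notMem (show -x₀ + piFinite K ι v ∉ (piLevelIdeal K ι 𝔫 : Set _) from hv), mul_zero]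

/-- **Stripping on the thin-coset test functions of level `𝔫`**: for `M` commuting with all finite
translations and with the finite modulations by `((𝔫𝒪̂)^ι)^♮`,
`M (Φ_∞ ⊗ 𝟙_{x₀ + (𝔫𝒪̂)^ι}) = (archFactor M (𝔫𝒪̂)^ι Φ_∞) ⊗ 𝟙_{x₀ + (𝔫𝒪̂)^ι}`. [folklore] -/
theorem map_thinCosetTestFunₗ (𝔫 : Ideal (𝓞 K))
    (hT : ∀ k, M ∘ₗ translateLM K ι (piAdeleSplit K ι (0, k)) =
      translateLM K ι (piAdeleSplit K ι (0, k)) ∘ₗ M)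
    (hM : ∀ y ∈ dualBox K ι (piLevelIdeal K ι 𝔫), M ∘ₗ modulateLM K ι (piAdeleSplit K ι (0, y)) =
      modulateLM K ι (piAdeleSplit K ι (0, y)) ∘ₗ M)
    (x₀ : ι → FiniteAdeleRing (𝓞 K) K) (Φinf : 𝓢((ι → mixedSpace K), ℂ)) :
    M (thinCosetTestFunₗ (K := K) (ι := ι) x₀ 𝔫 Φinf) =
      thinCosetTestFunₗ (K := K) (ι := ι) x₀ 𝔫
        (archFactor M (piLevelIdeal K ι 𝔫) (isOpen_piLevelIdeal K 𝔫) (isCompact_piLevelIdeal K ι 𝔫) Φinf) := by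
  rw [thinCosetTestFunₗ_eq_tmul, thinCosetTestFunₗ_eq_tmul]
  exact map_tmul_finTranslateSB_indicatorSB M _ _ _ hT hM Φinf (-x₀)

/-- **Stripping, all finite Heisenberg operators**: if `M` commutes with every finite translation and every
finite modulation then, for every compact open subgroup `L` and every `k`,
`M (φ ⊗ 𝟙_L(k + ·)) = (archFactor M L φ) ⊗ 𝟙_L(k + ·)`. [folklore] -/
theorem map_tmul_finTranslateSB_indicatorSB' (L : AddSubgroup (ι → FiniteAdeleRing (𝓞 K) K))
    (hLo : IsOpen (L : Set (ι → FiniteAdeleRing (𝓞 K) K)))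
    (hLc : IsCompact (L : Set (ι → FiniteAdeleRing (𝓞 K) K)))
    (hT : ∀ k, M ∘ₗ translateLM K ι (piAdeleSplit K ι (0, k)) =
      translateLM K ι (piAdeleSplit K ι (0, k)) ∘ₗ M)
    (hM : ∀ y, M ∘ₗ modulateLM K ι (piAdeleSplit K ι (0, y)) =
      modulateLM K ι (piAdeleSplit K ι (0, y)) ∘ₗ M)
    (Φinf : 𝓢((ι → mixedSpace K), ℂ)) (k : ι → FiniteAdeleRing (𝓞 K) K) :
    M (piSchwartzBruhatEquiv K ι (Φinf ⊗ₜ finTranslateSB K ι k (indicatorSB K ι L hLo hLc))) =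
      piSchwartzBruhatEquiv K ι
        (archFactor M L hLo hLc Φinf ⊗ₜ finTranslateSB K ι k (indicatorSB K ι L hLo hLc)) :=
  map_tmul_finTranslateSB_indicatorSB M L hLo hLc hT (fun y _ => hM y) Φinf k

end Stripping

/-! ## 6. Finite coset decompositions of level-`L` functions -/

section Cosets

variable {G : Type*} [AddCommGroup G]

/-- The indicator of the coset `q` of `H`, through a representative: `𝟙_{q.out + H}(x) = [q = x̄]`.
[folklore] -/
theorem indicator_out_vadd_apply (H : AddSubgroup G) (q : G ⧸ H) (x : G) :
    ((q.out : G) +ᵥ (H : Set G)).indicator (fun _ => (1 : ℂ)) x =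
      if q = (QuotientAddGroup.mk x : G ⧸ H) then 1 else 0 := by
  by_cases hq : q = (QuotientAddGroup.mk x : G ⧸ H)
  · rw [if_pos hq]
    exact indicator_vadd_addSubgroup_of_mem H _ 1
      (QuotientAddGroup.eq.1 ((QuotientAddGroup.out_eq' q).trans hq))
  · rw [if_neg hq]
    exact indicator_vadd_addSubgroup_of_not_mem H _ 1 fun h =>
      hq ((QuotientAddGroup.out_eq' q).symm.trans (QuotientAddGroup.eq.2 h))

/-- A finite combination of coset indicators, evaluated. [folklore] -/
theorem sum_mul_indicator_out_vadd (H : AddSubgroup G) (s : Finset (G ⧸ H)) (c : G ⧸ H → ℂ) (x : G) :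
    ∑ q ∈ s, c q * ((q.out : G) +ᵥ (H : Set G)).indicator (fun _ => (1 : ℂ)) x =
      if (QuotientAddGroup.mk x : G ⧸ H) ∈ s then c (QuotientAddGroup.mk x) else 0 := by
  simp_rw [indicator_out_vadd_apply, mul_ite, mul_one, mul_zero]
  exact Finset.sum_ite_eq' s _ c

variable [TopologicalSpace G] [IsTopologicalAddGroup G]

/-- **Finite coset decomposition**: a compactly supported function invariant under an open subgroup `H`
is a finite combination of indicators of cosets of `H`: `f = Σ_{q ∈ s} f(q.out) 𝟙_{q.out + H}`
(finite subcover of the support by cosets). [folklore] -/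
theorem exists_eq_sum_indicator_of_invariant (H : AddSubgroup G) (hHo : IsOpen (H : Set G))
    {f : G → ℂ} (hf : HasCompactSupport f) (hinv : ∀ x, ∀ l ∈ H, f (x + l) = f x) :
    ∃ s : Finset (G ⧸ H), f = fun x =>
      ∑ q ∈ s, f q.out * ((q.out : G) +ᵥ (H : Set G)).indicator (fun _ => (1 : ℂ)) x := by
  have hself : ∀ x : G, x ∈ x +ᵥ (H : Set G) := fun x => by
    rw [Set.mem_vadd_set_iff_neg_vadd_mem, vadd_eq_add, neg_add_cancel]
    exact H.zero_mem
  obtain ⟨t, ht⟩ := hf.isCompact.elim_finite_subcover (fun b : G => b +ᵥ (H : Set G))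
    (fun b => hHo.vadd b) (fun x _ => Set.mem_iUnion.2 ⟨x, hself x⟩)
  have hout : ∀ y : G, f ((QuotientAddGroup.mk y : G ⧸ H).out) = f y := fun y => by
    obtain ⟨h, hh⟩ := QuotientAddGroup.mk_out_eq_mul H y
    rw [hh, hinv y h h.2]
  refine ⟨t.image (QuotientAddGroup.mk : G → G ⧸ H), funext fun x => ?_⟩
  rw [sum_mul_indicator_out_vadd]
  split_ifs with hx
  · exact (hout x).symm
  · by_contra hfx
    have hx' : x ∈ tsupport f := subset_tsupport f (Function.mem_support.2 hfx)
    obtain ⟨b, hb, hxb⟩ := Set.mem_iUnion₂.1 (ht hx')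
    rw [Set.mem_vadd_set_iff_neg_vadd_mem, vadd_eq_add] at hxb
    exact hx (Finset.mem_image.2 ⟨b, hb, QuotientAddGroup.eq.2 hxb⟩)

end Cosets

/-! ## 7. Level independence of `archFactor` and the global form `M = A ⊗ 1` -/

section Global

variable {K : Type} [Field K] [NumberField K] {ι : Type} [Fintype ι]

omit [Fintype ι] in
/-- The translated indicator is a coset indicator: `𝟙_L(-c + ·) = 𝟙_{c + L}`. [folklore] -/
theorem coe_finTranslateSB_neg_indicatorSB (L : AddSubgroup (ι → FiniteAdeleRing (𝓞 K) K))
    (hLo : IsOpen (L : Set (ι → FiniteAdeleRing (𝓞 K) K)))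
    (hLc : IsCompact (L : Set (ι → FiniteAdeleRing (𝓞 K) K))) (c : ι → FiniteAdeleRing (𝓞 K) K) :
    ((finTranslateSB K ι (-c) (indicatorSB K ι L hLo hLc) : FinSB K ι) :
        (ι → FiniteAdeleRing (𝓞 K) K) → ℂ) =
      (c +ᵥ (L : Set (ι → FiniteAdeleRing (𝓞 K) K))).indicator fun _ => (1 : ℂ) := by
  rw [coe_finTranslateSB_apply, coe_indicatorSB]
  funext b
  by_cases hb : -c + b ∈ L
  · rw [Set.indicator_of_mem (show -c + b ∈ (L : Set _) from hb), indicator_vadd_addSubgroup_of_mem L c 1 hb]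
  · rw [Set.indicator_of_notMem (show -c + b ∉ (L : Set _) from hb),
      indicator_vadd_addSubgroup_of_not_mem L c 1 hb]

omit [Fintype ι] in
/-- **Coset decomposition in `𝒮((𝔸_K^∞)^ι)`**: an `L`-invariant Schwartz–Bruhat function is a finite
combination of translates of `𝟙_L`. [folklore] -/
theorem exists_eq_sum_smul_finTranslateSB_indicatorSB (L : AddSubgroup (ι → FiniteAdeleRing (𝓞 K) K))
    (hLo : IsOpen (L : Set (ι → FiniteAdeleRing (𝓞 K) K)))
    (hLc : IsCompact (L : Set (ι → FiniteAdeleRing (𝓞 K) K))) (f : FinSB K ι)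
    (hinv : ∀ x, ∀ l ∈ L, (f : (ι → FiniteAdeleRing (𝓞 K) K) → ℂ) (x + l) =
      (f : (ι → FiniteAdeleRing (𝓞 K) K) → ℂ) x) :
    ∃ s : Finset ((ι → FiniteAdeleRing (𝓞 K) K) ⧸ L), f = ∑ q ∈ s,
      (f : (ι → FiniteAdeleRing (𝓞 K) K) → ℂ) q.out •
        finTranslateSB K ι (-(q.out : ι → FiniteAdeleRing (𝓞 K) K)) (indicatorSB K ι L hLo hLc) := by
  obtain ⟨s, hs⟩ := exists_eq_sum_indicator_of_invariant L hLo f.2.2 hinv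
  refine ⟨s, Subtype.ext ?_⟩
  rw [AddSubmonoidClass.coe_finsetSum]
  conv_lhs => rw [hs]
  funext x
  rw [Finset.sum_apply]
  refine Finset.sum_congr rfl fun q _ => ?_
  rw [Submodule.coe_smul, Pi.smul_apply, smul_eq_mul, coe_finTranslateSB_neg_indicatorSB]

variable (M : ↥(piSchwartzBruhat K ι) →ₗ[ℂ] ↥(piSchwartzBruhat K ι))

/-- **Stripping at level `L`**: for `M` commuting with all finite translations and modulations and an
`L`-invariant `f ∈ 𝒮((𝔸_K^∞)^ι)`, `M (φ ⊗ f) = (archFactor M L φ) ⊗ f`. [folklore] -/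
theorem map_tmul_of_invariant
    (hT : ∀ k, M ∘ₗ translateLM K ι (piAdeleSplit K ι (0, k)) =
      translateLM K ι (piAdeleSplit K ι (0, k)) ∘ₗ M)
    (hM : ∀ y, M ∘ₗ modulateLM K ι (piAdeleSplit K ι (0, y)) =
      modulateLM K ι (piAdeleSplit K ι (0, y)) ∘ₗ M)
    (L : AddSubgroup (ι → FiniteAdeleRing (𝓞 K) K)) (hLo : IsOpen (L : Set (ι → FiniteAdeleRing (𝓞 K) K)))
    (hLc : IsCompact (L : Set (ι → FiniteAdeleRing (𝓞 K) K))) (f : FinSB K ι)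
    (hinv : ∀ x, ∀ l ∈ L, (f : (ι → FiniteAdeleRing (𝓞 K) K) → ℂ) (x + l) =
      (f : (ι → FiniteAdeleRing (𝓞 K) K) → ℂ) x)
    (Φinf : 𝓢((ι → mixedSpace K), ℂ)) :
    M (piSchwartzBruhatEquiv K ι (Φinf ⊗ₜ f)) =
      piSchwartzBruhatEquiv K ι (archFactor M L hLo hLc Φinf ⊗ₜ f) := by
  obtain ⟨s, hs⟩ := exists_eq_sum_smul_finTranslateSB_indicatorSB L hLo hLc f hinv
  rw [hs]
  simp only [TensorProduct.tmul_sum, TensorProduct.tmul_smul, _root_.map_sum, _root_.map_smul,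
    map_tmul_finTranslateSB_indicatorSB' M L hLo hLc hT hM]

/-- **Level independence**: for compact open subgroups `L' ≤ L`, `archFactor M L = archFactor M L'`.
[folklore] -/
theorem archFactor_eq_of_le
    (hT : ∀ k, M ∘ₗ translateLM K ι (piAdeleSplit K ι (0, k)) =
      translateLM K ι (piAdeleSplit K ι (0, k)) ∘ₗ M)
    (hM : ∀ y, M ∘ₗ modulateLM K ι (piAdeleSplit K ι (0, y)) =
      modulateLM K ι (piAdeleSplit K ι (0, y)) ∘ₗ M)
    {L L' : AddSubgroup (ι → FiniteAdeleRing (𝓞 K) K)} (hLo : IsOpen (L : Set (ι → FiniteAdeleRing (𝓞 K) K)))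
    (hLc : IsCompact (L : Set (ι → FiniteAdeleRing (𝓞 K) K)))
    (hL'o : IsOpen (L' : Set (ι → FiniteAdeleRing (𝓞 K) K)))
    (hL'c : IsCompact (L' : Set (ι → FiniteAdeleRing (𝓞 K) K))) (hle : L' ≤ L) :
    archFactor M L hLo hLc = archFactor M L' hL'o hL'c := by
  apply LinearMap.ext
  intro Φinf
  have hinv : ∀ x, ∀ l ∈ L', ((indicatorSB K ι L hLo hLc : FinSB K ι) :
      (ι → FiniteAdeleRing (𝓞 K) K) → ℂ) (x + l) =
      ((indicatorSB K ι L hLo hLc : FinSB K ι) : (ι → FiniteAdeleRing (𝓞 K) K) → ℂ) x := by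
    intro x l hl
    rw [coe_indicatorSB]
    by_cases hx : x ∈ L
    · rw [Set.indicator_of_mem (show x + l ∈ (L : Set _) from L.add_mem hx (hle hl)),
        Set.indicator_of_mem (show x ∈ (L : Set _) from hx)]
    · have hxl : x + l ∉ L := fun h => hx (by simpa using L.sub_mem h (hle hl))
      rw [Set.indicator_of_notMem (show x + l ∉ (L : Set _) from hxl),
        Set.indicator_of_notMem (show x ∉ (L : Set _) from hx)]
  rw [archFactor_apply M L, map_tmul_of_invariant M hT hM L' hL'o hL'c _ hinv, archSliceLM_tmul, coe_indicatorSB,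
    Set.indicator_of_mem (show (0 : ι → FiniteAdeleRing (𝓞 K) K) ∈ (L : Set _) from L.zero_mem), one_smul]

/-- **The archimedean part of `M`**: its archimedean factor at the reference level `𝒪̂^ι`
(`piLevelIdeal ⊤`); by `archFactor_eq_of_le` any level gives the same operator. [folklore] -/
def archPart : 𝓢((ι → mixedSpace K), ℂ) →ₗ[ℂ] 𝓢((ι → mixedSpace K), ℂ) :=
  archFactor M (piLevelIdeal K ι ⊤) (isOpen_piLevelIdeal K ⊤) (isCompact_piLevelIdeal K ι ⊤)

/-- **Stripping on all pure tensors**: for `M` commuting with all finite translations and modulations,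
`M (φ ⊗ f) = (archPart M φ) ⊗ f` for every `f ∈ 𝒮((𝔸_K^∞)^ι)` (every `f` has a level `(𝔫𝒪̂)^ι`,
`exists_level_of_mem_schwartzBruhat`). [folklore] -/
theorem map_tmul_eq_archPart_tmul
    (hT : ∀ k, M ∘ₗ translateLM K ι (piAdeleSplit K ι (0, k)) =
      translateLM K ι (piAdeleSplit K ι (0, k)) ∘ₗ M)
    (hM : ∀ y, M ∘ₗ modulateLM K ι (piAdeleSplit K ι (0, y)) =
      modulateLM K ι (piAdeleSplit K ι (0, y)) ∘ₗ M)
    (Φinf : 𝓢((ι → mixedSpace K), ℂ)) (f : FinSB K ι) :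
    M (piSchwartzBruhatEquiv K ι (Φinf ⊗ₜ f)) = piSchwartzBruhatEquiv K ι (archPart M Φinf ⊗ₜ f) := by
  obtain ⟨𝔫, h𝔫, hlev⟩ := exists_level_of_mem_schwartzBruhat K f.2
  rw [map_tmul_of_invariant M hT hM (piLevelIdeal K ι 𝔫) (isOpen_piLevelIdeal K 𝔫)
      (isCompact_piLevelIdeal K ι 𝔫) f hlev, archPart,
    archFactor_eq_of_le M hT hM (isOpen_piLevelIdeal K ⊤) (isCompact_piLevelIdeal K ι ⊤)
      (isOpen_piLevelIdeal K 𝔫) (isCompact_piLevelIdeal K ι 𝔫) (piLevelIdeal_mono K h𝔫 le_top)]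

/-- **`M = archPart M ⊗ 1`**: a linear endomorphism of `𝒮(𝔸_K^ι)` commuting with all finite Heisenberg
translations and modulations is the tensor product of its archimedean part with the identity of
`𝒮((𝔸_K^∞)^ι)`. [folklore] -/
theorem eq_adelicTensorEnd_archPart_id
    (hT : ∀ k, M ∘ₗ translateLM K ι (piAdeleSplit K ι (0, k)) =
      translateLM K ι (piAdeleSplit K ι (0, k)) ∘ₗ M)
    (hM : ∀ y, M ∘ₗ modulateLM K ι (piAdeleSplit K ι (0, y)) =
      modulateLM K ι (piAdeleSplit K ι (0, y)) ∘ₗ M) :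
    M = adelicTensorEnd (archPart M) LinearMap.id :=
  linearMap_ext_tensor fun Φinf f => by
    rw [map_tmul_eq_archPart_tmul M hT hM, adelicTensorEnd_apply_tmul, LinearMap.id_apply]

omit [Fintype ι] in
/-- `A ⊗ 1` determines `A`. [folklore] -/
theorem adelicTensorEnd_id_injective [Fintype ι] :
    Function.Injective fun A : 𝓢((ι → mixedSpace K), ℂ) →ₗ[ℂ] 𝓢((ι → mixedSpace K), ℂ) =>
      adelicTensorEnd (K := K) A (LinearMap.id : FinSB K ι →ₗ[ℂ] FinSB K ι) := by
  intro A A' h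
  apply LinearMap.ext
  intro Φinf
  set f₀ : FinSB K ι := indicatorSB K ι (piLevelIdeal K ι ⊤) (isOpen_piLevelIdeal K ⊤)
    (isCompact_piLevelIdeal K ι ⊤) with hf₀
  have hf₀0 : ((f₀ : FinSB K ι) : (ι → FiniteAdeleRing (𝓞 K) K) → ℂ) 0 = 1 := by
    rw [hf₀, coe_indicatorSB, Set.indicator_of_mem (show (0 : ι → FiniteAdeleRing (𝓞 K) K) ∈
      (piLevelIdeal K ι ⊤ : Set _) from (piLevelIdeal K ι ⊤).zero_mem)]
  have h1 := congrArg (fun N : Module.End ℂ ↥(piSchwartzBruhat K ι) =>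
    archSliceLM K ι 0 (N (piSchwartzBruhatEquiv K ι (Φinf ⊗ₜ f₀)))) h
  simp only [adelicTensorEnd_apply_tmul, LinearMap.id_apply, archSliceLM_tmul, hf₀0, one_smul] at h1
  exact h1

/-- **(S-∞), global form**: `M` commutes with all finite Heisenberg translations and modulations iff
`M = A ⊗ 1` for a (unique) linear operator `A` on `𝓢((K ⊗ ℝ)^ι)`. [folklore] -/
theorem existsUnique_eq_adelicTensorEnd_id
    (hT : ∀ k, M ∘ₗ translateLM K ι (piAdeleSplit K ι (0, k)) =
      translateLM K ι (piAdeleSplit K ι (0, k)) ∘ₗ M)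
    (hM : ∀ y, M ∘ₗ modulateLM K ι (piAdeleSplit K ι (0, y)) =
      modulateLM K ι (piAdeleSplit K ι (0, y)) ∘ₗ M) :
    ∃! A : 𝓢((ι → mixedSpace K), ℂ) →ₗ[ℂ] 𝓢((ι → mixedSpace K), ℂ), M = adelicTensorEnd A LinearMap.id :=
  ⟨archPart M, eq_adelicTensorEnd_archPart_id M hT hM, fun _ hA =>
    adelicTensorEnd_id_injective (hA.symm.trans (eq_adelicTensorEnd_archPart_id M hT hM))⟩

/-- Converse: `A ⊗ 1` commutes with every finite translation. [folklore] -/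
theorem adelicTensorEnd_id_comm_translateLM
    (A : 𝓢((ι → mixedSpace K), ℂ) →ₗ[ℂ] 𝓢((ι → mixedSpace K), ℂ)) (k : ι → FiniteAdeleRing (𝓞 K) K) :
    adelicTensorEnd A LinearMap.id ∘ₗ translateLM K ι (piAdeleSplit K ι (0, k)) =
      translateLM K ι (piAdeleSplit K ι (0, k)) ∘ₗ adelicTensorEnd A LinearMap.id := by
  rw [translateLM_finVec_eq_adelicTensorEnd, ← adelicTensorEnd_comp, ← adelicTensorEnd_comp,
    LinearMap.id_comp, LinearMap.comp_id, LinearMap.id_comp, LinearMap.comp_id]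

/-- Converse: `A ⊗ 1` commutes with every finite modulation. [folklore] -/
theorem adelicTensorEnd_id_comm_modulateLM
    (A : 𝓢((ι → mixedSpace K), ℂ) →ₗ[ℂ] 𝓢((ι → mixedSpace K), ℂ)) (y : ι → FiniteAdeleRing (𝓞 K) K) :
    adelicTensorEnd A LinearMap.id ∘ₗ modulateLM K ι (piAdeleSplit K ι (0, y)) =
      modulateLM K ι (piAdeleSplit K ι (0, y)) ∘ₗ adelicTensorEnd A LinearMap.id := by
  rw [modulateLM_finVec_eq_adelicTensorEnd, ← adelicTensorEnd_comp, ← adelicTensorEnd_comp,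
    LinearMap.id_comp, LinearMap.comp_id, LinearMap.id_comp, LinearMap.comp_id]

/-- **(S-∞), characterisation**: `M` commutes with all finite Heisenberg translations and modulations
iff `M = A ⊗ 1` for some linear `A` on `𝓢((K ⊗ ℝ)^ι)`. [folklore] -/
theorem comm_finite_heisenberg_iff :
    ((∀ k, M ∘ₗ translateLM K ι (piAdeleSplit K ι (0, k)) =
        translateLM K ι (piAdeleSplit K ι (0, k)) ∘ₗ M) ∧
      ∀ y, M ∘ₗ modulateLM K ι (piAdeleSplit K ι (0, y)) =
        modulateLM K ι (piAdeleSplit K ι (0, y)) ∘ₗ M) ↔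
    ∃ A : 𝓢((ι → mixedSpace K), ℂ) →ₗ[ℂ] 𝓢((ι → mixedSpace K), ℂ), M = adelicTensorEnd A LinearMap.id := by
  constructor
  · rintro ⟨hT, hM⟩
    exact ⟨archPart M, eq_adelicTensorEnd_archPart_id M hT hM⟩
  · rintro ⟨A, rfl⟩
    exact ⟨adelicTensorEnd_id_comm_translateLM A, adelicTensorEnd_id_comm_modulateLM A⟩

end Global

end Literature.NumberTheory.Automorphic
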